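import Literature.AlgebraicGeometry.Modules.CohFinitePresentation
import Literature.AlgebraicGeometry.Modules.FinitePresentationAffineChart
import Literature.AlgebraicGeometry.Modules.TildeLocallyFree
import HarnessLib

/-!
# Inverse images of finitely presented / coherent modules

Görtz–Wedhorn, *Algebraic Geometry I* (2nd ed.), Remark 7.23 / Prop. 7.24 (2) with Prop. 7.45;
The Stacks Project, Tag 01BQ ("the pullback `f^*𝒢` of a module of finite presentation is of finite
presentation") and Tag 01XZ/01Y6 (on locally noetherian schemes coherent = finitely presented):
for a morphism of schemes `f : X' → X` the inverse image `f^*M` of a finitely presented `𝒪_X`-module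
is finitely presented, hence — on locally noetherian schemes — **the inverse image of a coherent
module is coherent**.

Proof (affine charts): around `f(x')` choose an affine chart `g : Spec B → X` with `g^*M ≅ P̃`, `P`
finitely presented (tree `exists_affineChart`, GW I Prop. 7.26); around `x'` an affine open `W`
mapping into `g(Spec B)`; then `Spec Γ(W) → X' → X` factors as `Spec ψ ≫ g` and
`(f^*M)|_{Spec Γ(W)} ≅ (Spec ψ ≫ g)^*M ≅ (Spec ψ)^* P̃ ≅ (Γ(W) ⊗_B P)~` (pseudofunctoriality of
inverse images, Mathlib; GW I Prop. 7.24 (2), tree `pullbackSpecTildeIso`), which is finitely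
presented; finite presentation is local (tree `isFinitePresentation_of_openCover`).

* `isFinitePresentation_pullback` — `f^*` preserves finite presentation (any `f`);
* `coh_pullback` — **`Coh M → Coh (f^*M)`** for `X`, `X'` locally noetherian
  (tree `coh_iff_isFinitePresentation`).

Everything is proved; no named facts.

## References

* The Stacks Project, Tag 01BQ (pullback of finitely presented modules), Tag 01Y6. [StacksProject]
* U. Görtz, T. Wedhorn, *Algebraic Geometry I: Schemes*, 2nd ed. (2020), Rem. 7.23, Prop. 7.24 (2),
  Prop. 7.45. [GortzWedhorn2020]
-/

noncomputable section

-- `TopCat.Presheaf`/`Scheme.Modules` are not reducible (as in Mathlib's `AlgebraicGeometry/Modules`).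
set_option backward.isDefEq.respectTransparency false

open CategoryTheory AlgebraicGeometry Limits TopologicalSpace Opposite
open scoped TensorProduct

universe u

namespace Literature.AlgebraicGeometry.Modules

open Literature.AlgebraicGeometry.Morphisms

variable {X' X : Scheme.{u}} (f : X' ⟶ X) (M : X.Modules)

/-- **The affine chart of `f^*M`**: for `M` finitely presented and `x' ∈ X'` there is an affine open
`W ∋ x'` (inside any given open neighbourhood) over which `f^*M` is `Q̃` for a finitely presented
`Γ(W, 𝒪_{X'})`-module `Q` (namely `Γ(W) ⊗_B P` for a chart `g^*M ≅ P̃` at `f(x')`).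
[cite: StacksProject, Tag 01BQ] [cite: GortzWedhorn2020, Prop 7.24 (2)] -/
theorem exists_restrict_pullback_iso_tilde (hM : SheafOfModules.IsFinitePresentation.{u, u, u} M)
    (x' : X') {O : X'.Opens} (hx'O : x' ∈ O) :
    ∃ (W : X'.Opens) (hW : IsAffineOpen W) (Q : ModuleCat.{u} Γ(X', W))
      (_ : Module.FinitePresentation Γ(X', W) Q), x' ∈ W ∧ W ≤ O ∧
      Nonempty (((Scheme.Modules.pullback f).obj M).restrict hW.fromSpec ≅ tilde Q) := by
  obtain ⟨B, g, hg, P, hP, ⟨y, hy⟩, ⟨eP⟩⟩ := exists_affineChart M hM (f.base x')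
  -- an affine open `W ∋ x'` mapping into the chart `g(Spec B)`
  have hx'U : x' ∈ f ⁻¹ᵁ g.opensRange ⊓ O := ⟨show f.base x' ∈ Set.range g.base from ⟨y, hy⟩, hx'O⟩
  obtain ⟨W, hW, hx'W, hWle⟩ := Opens.isBasis_iff_nbhd.mp X'.isBasis_affineOpens hx'U
  have hWaff : IsAffineOpen W := hW
  -- `Spec Γ(W) → X' → X` factors through `g`
  let g' : Spec Γ(X', W) ⟶ X' := hWaff.fromSpec
  have hrange : Set.range (g' ≫ f).base ⊆ Set.range g.base := by
    rintro _ ⟨z, rfl⟩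
    have hz : g'.base z ∈ (W : Set X') := hWaff.range_fromSpec ▸ ⟨z, rfl⟩
    exact (hWle hz).1
  let l : Spec Γ(X', W) ⟶ Spec B := IsOpenImmersion.lift g (g' ≫ f) hrange
  have hl : l ≫ g = g' ≫ f := IsOpenImmersion.lift_fac g (g' ≫ f) hrange
  let ψ : B ⟶ Γ(X', W) := Spec.preimage l
  letI : Algebra B Γ(X', W) := ψ.hom.toAlgebra
  have hψ : l = Spec.map (CommRingCat.ofHom (algebraMap B Γ(X', W))) := by
    rw [show CommRingCat.ofHom (algebraMap B Γ(X', W)) = ψ from rfl, Spec.map_preimage]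
  -- `(f^*M)|_{Spec Γ(W)} ≅ g'^* f^* M ≅ (g' ≫ f)^* M ≅ (l ≫ g)^* M ≅ l^* g^* M ≅ l^* P̃ ≅ (Γ(W) ⊗ P)~`
  let Q : ModuleCat.{u} Γ(X', W) := ModuleCat.of (CommRingCat.of Γ(X', W)) (Γ(X', W) ⊗[B] P)
  have e : ((Scheme.Modules.pullback f).obj M).restrict hWaff.fromSpec ≅ tilde Q :=
    (Scheme.Modules.restrictFunctorIsoPullback g').app _ ≪≫
      (Scheme.Modules.pullbackComp g' f).app M ≪≫
      (Scheme.Modules.pullbackCongr hl.symm).app M ≪≫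
      ((Scheme.Modules.pullbackComp l g).symm).app M ≪≫
      (Scheme.Modules.pullback l).mapIso eP ≪≫
      (Scheme.Modules.pullbackCongr hψ).app _ ≪≫
      pullbackSpecTildeIso P
  exact ⟨W, hWaff, Q, inferInstance, hx'W, fun z hz => (hWle hz).2, ⟨e⟩⟩

/-- **`f^*` preserves finite presentation** (The Stacks Project, Tag 01BQ).
[cite: StacksProject, Tag 01BQ] -/
theorem isFinitePresentation_pullback (hM : SheafOfModules.IsFinitePresentation.{u, u, u} M) :
    SheafOfModules.IsFinitePresentation.{u, u, u} ((Scheme.Modules.pullback f).obj M) := by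
  choose W hW Q hQ hx'W _ e using fun x' : X' =>
    exists_restrict_pullback_iso_tilde f M hM x' (Opens.mem_top x')
  let 𝒰 : X'.OpenCover :=
    Scheme.Cover.mkOfCovers (X' : Type u) (fun x' => Spec Γ(X', W x')) (fun x' => (hW x').fromSpec)
      fun x' => by
        have hx : x' ∈ Set.range (hW x').fromSpec.base := by rw [(hW x').range_fromSpec]; exact hx'W x'
        obtain ⟨z, hz⟩ := hx
        exact ⟨x', z, hz⟩
  refine isFinitePresentation_of_openCover _ 𝒰 fun x' => ?_
  haveI := hQ x'
  exact isFinitePresentation_of_iso (e x').some.symm (isFinitePresentation_tilde (Q x'))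

/-- **The inverse image of a coherent module is coherent** (`X`, `X'` locally noetherian): coherent
= finitely presented on locally noetherian schemes, and `f^*` preserves finite presentation.
[cite: StacksProject, Tag 01BQ] [cite: GortzWedhorn2020, Prop 7.45] -/
theorem coh_pullback [IsLocallyNoetherian X] [IsLocallyNoetherian X'] (hM : Coh M) :
    Coh ((Scheme.Modules.pullback f).obj M) :=
  coh_of_isFinitePresentation _
    (isFinitePresentation_pullback f M (isFinitePresentation_of_coh M hM))

end Literature.AlgebraicGeometry.Modules

end
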